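import Summits.NavierStokesRegularity.NavierStokesRegularity.Theorems.CoriolisHeadTypeIRateReduction
import Mathlib.Analysis.Calculus.FDeriv.Symmetric
import Mathlib.Analysis.SpecialFunctions.Pow.Real
import Mathlib.Analysis.Calculus.MeanValue
import HarnessLib

/-!
# CoriolisHeadTypeIRateGradientTransport — crux `NoCoRotatingCore` (stmt-NavierStokesRegularity-22676), line
# `far_field_constancy` v2 (skeleton 15c9a82ad206abb9), stub K1c `stub_typeIRate`: the GRADIENT of a rotated profile
# along the spiral characteristics (damping `2a`)

Two ingredients of the derivative gain behind K1c (see `CoriolisHeadTypeIRateOfLaplacianGradientDecay.lean`):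

* §1 `fderiv_transport_form_of_rotated` — differentiating the rotated Leray profile system
  `−νΔU + aU + a(y·∇)U + (BU − (By·∇)U) + (U·∇)U + ∇P = 0` and using the symmetry of `D²U`:
  `D(DU)(y)(ay − By)e + 2a·DU(y)e + B(DU(y)e) − DU(y)(Be) = νD(ΔU)(y)e − DU(y)(DU(y)e) − D(DU)(y)(U y)e − D(∇P)(y)e`;
  the gradient is transported with DAMPING `2a` (one extra `a` from `∂ₑ(y·∇U) = ∂ₑU + y·∇∂ₑU`) and its direction
  index is rotated by `−DU∘B`.
* §2 `sq_mul_norm_le_of_transport_two` — the MATRIX transport lemma: for `𝕎 : ℝ³ → (ℝ³ →L ℝ³)` with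
  `‖𝕎‖ ≤ m` on `‖y‖ = R` and `‖D𝕎·(ay − By) + 2a𝕎 + B∘𝕎 − 𝕎∘B‖ ≤ D/‖y‖²` beyond `R`:
  `‖y‖²‖𝕎(y)‖ ≤ R²m + (D/a) log(‖y‖/R)`.  Proof: conjugate by the rotation group, `Z(s) = e^{2as} exp(sB) 𝕎(γ(s))
  exp(−sB)` along `γ(s) = exp(s(a − B))y₀` (`hasDerivAt_conj_exp_smul`, `norm_conj_exp_smul_skew`: the commutator
  `B∘𝕎 − 𝕎∘B` is absorbed and the conjugation is isometric for skew `B`), so `‖Z'‖ = e^{2as}‖G(γ(s))‖ ≤ D/R²`; a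
  `1/r²` forcing integrates to a LOGARITHM against the homogeneous decay `(R/r)²` — the mechanism by which `DU`
  gains almost a full power once its forcing is `O(r⁻²)`.

Everything is proved; no definitions, no named facts.  WHAT THIS IS NOT: K1c, K1a, `NoCoRotatingCore` stay OPEN;
nothing here proves Pineau–Vicol's conjecture or NS regularity.

References: line card `Cruxes/NoCoRotatingCore/Lines/far_field_constancy.md` (K1c: «derivative gain — the
differentiated system carries the extra damping»); B. Pineau, V. Vicol, arXiv:2607.09619 (2026), (1.8), Prop. 3.1
[PineauVicol2026].
-/

noncomputable section

open Set Function Filter Topology Metric InnerProductSpace Real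

-- the summit and its single sub-problem share the name (CONVENTIONS §1), as in every Theorems file
set_option linter.dupNamespace false
-- nested operator types `ℝ³ →L[ℝ] ℝ³ →L[ℝ] ℝ³` inside the Banach algebra `ℝ³ →L[ℝ] ℝ³`
set_option maxSynthPendingDepth 3

namespace Summit.NavierStokesRegularity.NavierStokesRegularity.Theorems.CoriolisHead

namespace TypeIRate

open Literature.Analysis.FluidPDE
open scoped RealInnerProductSpace Laplacian ContDiff

/-! ## §1 The differentiated profile system in transport form -/

section Profile

variable {ν a : ℝ} {B : EuclideanSpace ℝ (Fin 3) →L[ℝ] EuclideanSpace ℝ (Fin 3)}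
  {U : EuclideanSpace ℝ (Fin 3) → EuclideanSpace ℝ (Fin 3)} {P : EuclideanSpace ℝ (Fin 3) → ℝ}

/-- **The gradient of a rotated Leray profile solves a transport system with damping `2a`.**  Differentiating
`−νΔU + aU + a(y·∇)U + (BU − (By·∇)U) + (U·∇)U + ∇P = 0` in the direction `e` and using the symmetry of `D²U`:
`D(DU)(y)(ay − By) e + 2a·DU(y)e + B(DU(y)e) − DU(y)(Be) = ν D(ΔU)(y)e − DU(y)(DU(y)e) − D(DU)(y)(U y) e − D(∇P)(y) e`
(the extra damping `a` comes from `∂ₑ(y·∇U) = ∂ₑU + y·∇∂ₑU`; the coupling `−DU(Be)` rotates the direction index).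
[cite: PineauVicol2026, (1.8a) (p. 3)] -/
theorem fderiv_transport_form_of_rotated (hU : ContDiff ℝ (⊤ : ℕ∞) U) (hP : ContDiff ℝ 2 P)
    (heq : ∀ y, -(ν • (Δ U) y) + a • U y + a • fderiv ℝ U y y + (B (U y) - fderiv ℝ U y (B y)) +
      convect U U y + gradient P y = 0) (y e : EuclideanSpace ℝ (Fin 3)) :
    fderiv ℝ (fderiv ℝ U) y (a • y - B y) e + (2 * a) • fderiv ℝ U y e + B (fderiv ℝ U y e)
        - fderiv ℝ U y (B e) =
      ν • fderiv ℝ (Δ U) y e - fderiv ℝ U y (fderiv ℝ U y e) - fderiv ℝ (fderiv ℝ U) y (U y) e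
        - fderiv ℝ (gradient P) y e := by
  -- differentiability facts
  have hU2 : ContDiff ℝ 2 U := hU.of_le (by norm_cast)
  have hU3 : ContDiff ℝ 3 U := hU.of_le (by norm_cast)
  have hUd : Differentiable ℝ U := hU.differentiable (by simp)
  have hDU : ContDiff ℝ 1 (fderiv ℝ U) := hU2.fderiv_right (m := 1) (by norm_cast)
  have hDUd : Differentiable ℝ (fderiv ℝ U) := hDU.differentiable one_ne_zero
  have hΔd : Differentiable ℝ (Δ U) := differentiable_laplacian hU3
  have hP1 : ContDiff ℝ 1 P := hP.of_le one_le_two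
  have hgradd : Differentiable ℝ (gradient P) := by
    have : gradient P = fun z => (InnerProductSpace.toDual ℝ (EuclideanSpace ℝ (Fin 3))).symm (fderiv ℝ P z) :=
      rfl
    rw [this]
    exact (InnerProductSpace.toDual ℝ (EuclideanSpace ℝ (Fin 3))).symm.differentiable.comp
      ((hP.fderiv_right (m := 1) (by norm_cast)).differentiable one_ne_zero)
  -- the seven terms and their derivatives at `y`
  have h1 : HasFDerivAt (fun z => -(ν • (Δ U) z)) (-(ν • fderiv ℝ (Δ U) y)) y :=
    ((hΔd y).hasFDerivAt.const_smul ν).neg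
  have h2 : HasFDerivAt (fun z => a • U z) (a • fderiv ℝ U y) y := (hUd y).hasFDerivAt.const_smul a
  have h3 : HasFDerivAt (fun z => a • fderiv ℝ U z z)
      (a • ((fderiv ℝ U y).comp (ContinuousLinearMap.id ℝ _) + (fderiv ℝ (fderiv ℝ U) y).flip y)) y :=
    ((hDUd y).hasFDerivAt.clm_apply (hasFDerivAt_id y)).const_smul a
  have h4 : HasFDerivAt (fun z => B (U z)) (B.comp (fderiv ℝ U y)) y :=
    B.hasFDerivAt.comp y (hUd y).hasFDerivAt
  have h5 : HasFDerivAt (fun z => fderiv ℝ U z (B z))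
      ((fderiv ℝ U y).comp B + (fderiv ℝ (fderiv ℝ U) y).flip (B y)) y :=
    (hDUd y).hasFDerivAt.clm_apply B.hasFDerivAt
  have h6 : HasFDerivAt (convect U U)
      ((fderiv ℝ U y).comp (fderiv ℝ U y) + (fderiv ℝ (fderiv ℝ U) y).flip (U y)) y := by
    have h := (hDUd y).hasFDerivAt.clm_apply (hUd y).hasFDerivAt
    have hc : convect U U = fun z => fderiv ℝ U z (U z) := funext fun z => convect_apply U U z
    rw [hc]
    exact h
  have h7 : HasFDerivAt (gradient P) (fderiv ℝ (gradient P) y) y := (hgradd y).hasFDerivAt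
  have hsum := ((((h1.add h2).add h3).add (h4.sub h5)).add h6).add h7
  -- the sum is the zero function
  have hfun : ((((((fun z => -(ν • (Δ U) z)) + fun z => a • U z) + fun z => a • fderiv ℝ U z z) +
      ((fun z => B (U z)) - fun z => fderiv ℝ U z (B z))) + convect U U) + gradient P) =
      fun _ => (0 : EuclideanSpace ℝ (Fin 3)) := by
    funext z
    simp only [Pi.add_apply, Pi.sub_apply]
    exact heq z
  rw [hfun] at hsum
  have hD := (hsum.unique (hasFDerivAt_const (0 : EuclideanSpace ℝ (Fin 3)) y)).symm
  -- evaluate at `e`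
  have hDe := congrArg (fun L : EuclideanSpace ℝ (Fin 3) →L[ℝ] EuclideanSpace ℝ (Fin 3) => L e) hD
  simp only [_root_.zero_apply, _root_.add_apply, _root_.sub_apply, _root_.neg_apply, _root_.smul_apply,
    ContinuousLinearMap.comp_apply, ContinuousLinearMap.flip_apply, ContinuousLinearMap.id_apply] at hDe
  -- symmetry of the second derivative
  have hsym : IsSymmSndFDerivAt ℝ U y := (hU2.contDiffAt (x := y)).isSymmSndFDerivAt (by simp)
  rw [hsym e (B y), hsym e (U y), hsym e y] at hDe
  -- linear algebra
  have hV : fderiv ℝ (fderiv ℝ U) y (a • y - B y) e =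
      a • fderiv ℝ (fderiv ℝ U) y y e - fderiv ℝ (fderiv ℝ U) y (B y) e := by
    rw [map_sub, map_smul]; rfl
  rw [hV]
  -- from `0 = Σ` solve for the claimed identity
  have key : -(ν • fderiv ℝ (Δ U) y e) + a • fderiv ℝ U y e +
      a • (fderiv ℝ U y e + fderiv ℝ (fderiv ℝ U) y y e) +
      (B (fderiv ℝ U y e) - (fderiv ℝ U y (B e) + fderiv ℝ (fderiv ℝ U) y (B y) e)) +
      (fderiv ℝ U y (fderiv ℝ U y e) + fderiv ℝ (fderiv ℝ U) y (U y) e) +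
      fderiv ℝ (gradient P) y e = 0 := by
    rw [← hDe]
  rw [two_mul, add_smul, smul_add] at *
  -- move everything to one side
  rw [← sub_eq_zero]
  rw [← sub_eq_zero] at key
  rw [← key]
  abel

end Profile

/-! ## §2 The matrix transport lemma with damping `2a` (two-sided conjugation by `exp(sB)`) -/

/-- For skew `B`, `exp(sB)` has operator norm `≤ 1`. [folklore] -/
theorem opNorm_exp_smul_skew_le {B : EuclideanSpace ℝ (Fin 3) →L[ℝ] EuclideanSpace ℝ (Fin 3)}
    (hB : ∀ x, inner ℝ (B x) x = 0) (s : ℝ) : ‖NormedSpace.exp (s • B)‖ ≤ 1 :=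
  ContinuousLinearMap.opNorm_le_bound _ zero_le_one fun v => by
    rw [norm_exp_smul_skew hB, one_mul]

/-- `exp(sB) ∘ exp(−sB) = 1` and `exp(−sB) ∘ exp(sB) = 1`. [folklore] -/
theorem exp_smul_mul_exp_neg_smul (B : EuclideanSpace ℝ (Fin 3) →L[ℝ] EuclideanSpace ℝ (Fin 3)) (s : ℝ) :
    NormedSpace.exp (s • B) * NormedSpace.exp ((-s) • B) = 1 ∧
      NormedSpace.exp ((-s) • B) * NormedSpace.exp (s • B) = 1 := by
  constructor
  · rw [← rss_exp_add_smul, add_neg_cancel, zero_smul, NormedSpace.exp_zero]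
  · rw [← rss_exp_add_smul, neg_add_cancel, zero_smul, NormedSpace.exp_zero]

/-- For skew `B`, conjugation `X ↦ exp(sB) X exp(−sB)` preserves the operator norm. [folklore] -/
theorem norm_conj_exp_smul_skew {B : EuclideanSpace ℝ (Fin 3) →L[ℝ] EuclideanSpace ℝ (Fin 3)}
    (hB : ∀ x, inner ℝ (B x) x = 0) (s : ℝ)
    (X : EuclideanSpace ℝ (Fin 3) →L[ℝ] EuclideanSpace ℝ (Fin 3)) :
    ‖NormedSpace.exp (s • B) * X * NormedSpace.exp ((-s) • B)‖ = ‖X‖ := by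
  set E := NormedSpace.exp (s • B) with hE
  set E' := NormedSpace.exp ((-s) • B) with hE'
  have hEn : ‖E‖ ≤ 1 := opNorm_exp_smul_skew_le hB s
  have hE'n : ‖E'‖ ≤ 1 := opNorm_exp_smul_skew_le hB (-s)
  have hE'E : E' * E = 1 := (exp_smul_mul_exp_neg_smul B s).2
  apply le_antisymm
  · calc ‖E * X * E'‖ ≤ ‖E * X‖ * ‖E'‖ := norm_mul_le _ _
      _ ≤ ‖E‖ * ‖X‖ * ‖E'‖ := mul_le_mul_of_nonneg_right (norm_mul_le _ _) (norm_nonneg _)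
      _ ≤ 1 * ‖X‖ * 1 := by
          refine mul_le_mul (mul_le_mul_of_nonneg_right hEn (norm_nonneg _)) hE'n
            (norm_nonneg _) (by positivity)
      _ = ‖X‖ := by ring
  · have hX : X = E' * (E * X * E') * E := by
      rw [show E' * (E * X * E') * E = (E' * E) * X * (E' * E) by simp only [mul_assoc], hE'E,
        one_mul, mul_one]
    calc ‖X‖ = ‖E' * (E * X * E') * E‖ := by rw [← hX]
      _ ≤ ‖E' * (E * X * E')‖ * ‖E‖ := norm_mul_le _ _
      _ ≤ ‖E'‖ * ‖E * X * E'‖ * ‖E‖ := mul_le_mul_of_nonneg_right (norm_mul_le _ _) (norm_nonneg _)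
      _ ≤ 1 * ‖E * X * E'‖ * 1 := by
          refine mul_le_mul (mul_le_mul_of_nonneg_right hE'n (norm_nonneg _)) hEn
            (norm_nonneg _) (by positivity)
      _ = ‖E * X * E'‖ := by ring

/-- The derivative of `s ↦ exp(−sB)`. [folklore] -/
theorem hasDerivAt_exp_neg_smul (B : EuclideanSpace ℝ (Fin 3) →L[ℝ] EuclideanSpace ℝ (Fin 3)) (s : ℝ) :
    HasDerivAt (fun s : ℝ => NormedSpace.exp ((-s) • B)) (-(B * NormedSpace.exp ((-s) • B))) s := by
  have h1 : HasDerivAt (fun u : ℝ => NormedSpace.exp (u • B)) (B * NormedSpace.exp ((-s) • B)) (-s) :=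
    hasDerivAt_exp_smul_const' (𝕂 := ℝ) B (-s)
  have h2 := h1.scomp s (hasDerivAt_neg s)
  have h3 : ((fun u : ℝ => NormedSpace.exp (u • B)) ∘ Neg.neg) =
      fun s : ℝ => NormedSpace.exp ((-s) • B) := rfl
  rw [h3, neg_one_smul] at h2
  exact h2

/-- **Derivative of a conjugated operator family**: if `X' ` is the derivative of `X` at `s` then
`d/ds [exp(sB) X(s) exp(−sB)] = exp(sB) (X' + B X(s) − X(s) B) exp(−sB)`. [folklore] -/
theorem hasDerivAt_conj_exp_smul (B : EuclideanSpace ℝ (Fin 3) →L[ℝ] EuclideanSpace ℝ (Fin 3))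
    {X : ℝ → (EuclideanSpace ℝ (Fin 3) →L[ℝ] EuclideanSpace ℝ (Fin 3))}
    {X' : EuclideanSpace ℝ (Fin 3) →L[ℝ] EuclideanSpace ℝ (Fin 3)} {s : ℝ} (hX : HasDerivAt X X' s) :
    HasDerivAt (fun s : ℝ => NormedSpace.exp (s • B) * X s * NormedSpace.exp ((-s) • B))
      (NormedSpace.exp (s • B) * (X' + (B * X s - X s * B)) * NormedSpace.exp ((-s) • B)) s := by
  have hE : HasDerivAt (fun s : ℝ => NormedSpace.exp (s • B)) (B * NormedSpace.exp (s • B)) s :=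
    hasDerivAt_exp_smul_const' (𝕂 := ℝ) B s
  have hE' := hasDerivAt_exp_neg_smul B s
  have h1 := hE.mul hX
  have h2 := h1.mul hE'
  refine h2.congr_deriv ?_
  set E := NormedSpace.exp (s • B) with hEdef
  set F := NormedSpace.exp ((-s) • B) with hFdef
  have hEB : B * E = E * B := (((Commute.refl B).smul_right s).exp_right).eq
  rw [hEB]
  simp only [mul_add, add_mul, mul_sub, sub_mul, mul_neg, mul_assoc]
  abel

/-- **Matrix transport with damping `2a`.**  Let `a > 0`, `B` skew, `𝕎 : ℝ³ → (ℝ³ →L ℝ³)` differentiable with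
`‖𝕎(y)‖ ≤ m` on the sphere `‖y‖ = R` (`R > 0`), and suppose that beyond `R` the transport expression with damping
`2a` and the ROTATION OF THE DIRECTION INDEX, `G = D𝕎·(ay − By) + 2a𝕎 + B∘𝕎 − 𝕎∘B`, obeys `‖G(y)‖ ≤ D/‖y‖²`.
Then `‖y‖² ‖𝕎(y)‖ ≤ R² m + (D/a) log(‖y‖/R)` beyond `R`.  Proof: along `γ(s) = exp(s(a − B))y₀` the conjugated
unknown `Z(s) = e^{2as} exp(sB) 𝕎(γ(s)) exp(−sB)` has `Z' = e^{2as} exp(sB) G(γ(s)) exp(−sB)`, so `‖Z'‖ ≤ D/R²`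
(constant): the homogeneous decay is `e^{−2as} = (R/‖y‖)²` and a `1/r²` forcing integrates to a LOGARITHM — this is
how the gradient of a profile gains almost a full power (`DU = O(log r / r²)`) once its forcing is `O(r⁻²)`. [folklore] -/
theorem sq_mul_norm_le_of_transport_two {a : ℝ} (ha : 0 < a)
    {B : EuclideanSpace ℝ (Fin 3) →L[ℝ] EuclideanSpace ℝ (Fin 3)} (hB : ∀ x, inner ℝ (B x) x = 0)
    {𝕎 : EuclideanSpace ℝ (Fin 3) → (EuclideanSpace ℝ (Fin 3) →L[ℝ] EuclideanSpace ℝ (Fin 3))}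
    (hW : Differentiable ℝ 𝕎) {R D m : ℝ} (hR : 0 < R)
    (hm : ∀ y : EuclideanSpace ℝ (Fin 3), ‖y‖ = R → ‖𝕎 y‖ ≤ m)
    (hG : ∀ y : EuclideanSpace ℝ (Fin 3), R ≤ ‖y‖ →
      ‖fderiv ℝ 𝕎 y (a • y - B y) + (2 * a) • 𝕎 y + ((B.comp (𝕎 y)) - (𝕎 y).comp B)‖ ≤ D / ‖y‖ ^ 2)
    {y : EuclideanSpace ℝ (Fin 3)} (hy : R ≤ ‖y‖) :
    ‖y‖ ^ 2 * ‖𝕎 y‖ ≤ R ^ 2 * m + D / a * Real.log (‖y‖ / R) := by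
  obtain ⟨y₀, s₁, hy₀, hs₁, hexp, hflow⟩ := exists_flow_eq ha hB hR hy
  set A : EuclideanSpace ℝ (Fin 3) →L[ℝ] EuclideanSpace ℝ (Fin 3) :=
    a • (1 : EuclideanSpace ℝ (Fin 3) →L[ℝ] EuclideanSpace ℝ (Fin 3)) - B with hA
  set γ : ℝ → EuclideanSpace ℝ (Fin 3) := fun s => NormedSpace.exp (s • A) y₀ with hγdef
  have hγ : ∀ s, HasDerivAt γ (a • γ s - B (γ s)) s := fun s => by
    have h := hasDerivAt_flow A y₀ s
    rwa [drift_apply] at h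
  have hγn : ∀ s, ‖γ s‖ = Real.exp (a * s) * R := fun s => by
    rw [← hy₀]; exact norm_flow hB a y₀ s
  have hγs₁ : γ s₁ = y := hflow
  -- the transport expression
  set G : EuclideanSpace ℝ (Fin 3) → (EuclideanSpace ℝ (Fin 3) →L[ℝ] EuclideanSpace ℝ (Fin 3)) :=
    fun z => fderiv ℝ 𝕎 z (a • z - B z) + (2 * a) • 𝕎 z + ((B.comp (𝕎 z)) - (𝕎 z).comp B) with hGdef
  -- the conjugated unknown and its derivative
  set Z : ℝ → (EuclideanSpace ℝ (Fin 3) →L[ℝ] EuclideanSpace ℝ (Fin 3)) := fun s =>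
    Real.exp (2 * a * s) • (NormedSpace.exp (s • B) * 𝕎 (γ s) * NormedSpace.exp ((-s) • B)) with hZdef
  set Z' : ℝ → (EuclideanSpace ℝ (Fin 3) →L[ℝ] EuclideanSpace ℝ (Fin 3)) := fun s =>
    Real.exp (2 * a * s) • (NormedSpace.exp (s • B) * G (γ s) * NormedSpace.exp ((-s) • B)) with hZ'def
  have hZ : ∀ s, HasDerivAt Z (Z' s) s := by
    intro s
    have hu : HasDerivAt (fun s => 𝕎 (γ s)) (fderiv ℝ 𝕎 (γ s) (a • γ s - B (γ s))) s :=
      (hW (γ s)).hasFDerivAt.comp_hasDerivAt s (hγ s)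
    have hc := hasDerivAt_conj_exp_smul B hu
    have he : HasDerivAt (fun s : ℝ => Real.exp (2 * a * s)) (Real.exp (2 * a * s) * (2 * a)) s := by
      have h := ((hasDerivAt_id s).const_mul (2 * a)).exp
      simpa using h
    have hZ₁ := he.smul hc
    refine hZ₁.congr_deriv ?_
    rw [hZ'def]
    set E := NormedSpace.exp (s • B) with hE
    set F := NormedSpace.exp ((-s) • B) with hF
    set W := 𝕎 (γ s) with hW'
    set W₁ := fderiv ℝ 𝕎 (γ s) (a • γ s - B (γ s)) with hW₁
    have hG' : G (γ s) = W₁ + (2 * a) • W + (B * W - W * B) := by rw [hGdef]; rfl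
    simp only [hG']
    have e1 : E * (W₁ + (2 * a) • W + (B * W - W * B)) * F =
        E * (W₁ + (B * W - W * B)) * F + (2 * a) • (E * W * F) := by
      rw [show W₁ + (2 * a) • W + (B * W - W * B) = (W₁ + (B * W - W * B)) + (2 * a) • W by abel,
        mul_add, add_mul, mul_smul_comm, smul_mul_assoc]
    rw [e1, smul_add, ← mul_smul, mul_comm (Real.exp (2 * a * s)) (2 * a), mul_smul, mul_smul]
  -- the derivative bound
  have hZ'n : ∀ s ∈ Ico (0 : ℝ) s₁, ‖Z' s‖ ≤ D / R ^ 2 := by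
    intro s hs
    have hes : 1 ≤ Real.exp (a * s) := Real.one_le_exp (mul_nonneg ha.le hs.1)
    have hγR : R ≤ ‖γ s‖ := by rw [hγn]; nlinarith
    have hGs := hG (γ s) hγR
    rw [hγn] at hGs
    rw [hZ'def]
    simp only
    rw [norm_smul, Real.norm_of_nonneg (Real.exp_pos _).le, norm_conj_exp_smul_skew hB]
    calc Real.exp (2 * a * s) * ‖G (γ s)‖ ≤ Real.exp (2 * a * s) * (D / (Real.exp (a * s) * R) ^ 2) :=
          mul_le_mul_of_nonneg_left hGs (Real.exp_pos _).le
      _ = D / R ^ 2 := by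
          rw [show (2 : ℝ) * a * s = a * s + a * s by ring, Real.exp_add]
          field_simp
  -- integrate: `‖Z s₁‖ ≤ m + (D/R²) s₁`
  set Bnd : ℝ → ℝ := fun s => m + D / R ^ 2 * s with hBnd
  have hBndd : ∀ s, HasDerivAt Bnd (D / R ^ 2) s := fun s => by
    have h1 : HasDerivAt (fun x : ℝ => D / R ^ 2 * x) (D / R ^ 2 * 1) s := (hasDerivAt_id s).const_mul _
    have h2 := h1.const_add m
    rw [mul_one] at h2
    exact h2
  have hZ0 : ‖Z 0‖ ≤ Bnd 0 := by
    have hγ0 : γ 0 = y₀ := by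
      change NormedSpace.exp ((0 : ℝ) • A) y₀ = y₀
      rw [zero_smul, NormedSpace.exp_zero]; rfl
    rw [hZdef, hBnd]
    simp only [mul_zero, Real.exp_zero, one_smul, add_zero, neg_zero, zero_smul, NormedSpace.exp_zero,
      one_mul, mul_one, hγ0]
    exact hm y₀ hy₀
  have hcont : ContinuousOn Z (Icc 0 s₁) := fun s _ => (hZ s).continuousAt.continuousWithinAt
  have hfence := image_norm_le_of_norm_deriv_right_le_deriv_boundary hcont
    (fun s _ => (hZ s).hasDerivWithinAt) hZ0 hBndd hZ'n (right_mem_Icc.2 hs₁)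
  -- unpack at `s₁`
  have hexp1 : Real.exp (a * s₁) = ‖y‖ / R := by rw [← hexp]; field_simp
  have hZ1 : ‖Z s₁‖ = (‖y‖ / R) ^ 2 * ‖𝕎 y‖ := by
    rw [hZdef]
    simp only
    rw [norm_smul, Real.norm_of_nonneg (Real.exp_pos _).le, norm_conj_exp_smul_skew hB, hγs₁,
      show (2 : ℝ) * a * s₁ = a * s₁ + a * s₁ by ring, Real.exp_add, hexp1]
    ring
  have hs₁eq : s₁ = Real.log (‖y‖ / R) / a := by
    have h : a * s₁ = Real.log (‖y‖ / R) := by rw [← hexp1, Real.log_exp]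
    rw [← h]; field_simp
  have key : (‖y‖ / R) ^ 2 * ‖𝕎 y‖ ≤ m + D / R ^ 2 * s₁ := by rw [← hZ1]; exact hfence
  rw [hs₁eq] at key
  have h2 := mul_le_mul_of_nonneg_left key (pow_pos hR 2).le
  have hn : 0 < ‖y‖ := hR.trans_le hy
  have e1 : ‖y‖ ^ 2 * ‖𝕎 y‖ = R ^ 2 * ((‖y‖ / R) ^ 2 * ‖𝕎 y‖) := by
    rw [div_pow, ← mul_assoc, mul_div_cancel₀ _ (pow_ne_zero 2 hR.ne')]
  have e2 : R ^ 2 * (m + D / R ^ 2 * (Real.log (‖y‖ / R) / a)) =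
      R ^ 2 * m + D / a * Real.log (‖y‖ / R) := by
    have hR2 : R ^ 2 ≠ 0 := pow_ne_zero 2 hR.ne'
    rw [mul_add, ← mul_assoc, mul_div_cancel₀ _ hR2]
    ring
  rw [e1, ← e2]
  exact h2

end TypeIRate

end Summit.NavierStokesRegularity.NavierStokesRegularity.Theorems.CoriolisHead

end
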